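import Summits.BirchSwinnertonDyer.BirchSwinnertonDyer.Theorems.ByReductionTypeAtTwoOrdKatoHalfAtTwoIsoZetaColemanMuIotaTranspose
import HarnessLib

/-!
# Route ByReductionTypeAtTwo, crux `OrdKatoHalfAtTwoIso` (stmt-BirchSwinnertonDyer-19573), line `steinberg-fibre-at-two`,
# F1 slot (child stmt-BirchSwinnertonDyer-23959): the `ι`-semilinear transpose needs only an ADJOINT source pairing —
# no bijectivity, no local nilpotence on the local side

Seat `cruxlead-stmt-BirchSwinnertonDyer-19573-w3` g3 (prover WIDTH under the LEAD `cruxlead-19573` g5; HOME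
`run/shared/lean/pub/bsd-2adic/`; `--supports` stmt-BirchSwinnertonDyer-23959). THEOREMS ONLY (no definition, no named fact,
no `sorry`, no instance). HONEST FRAMING (cell bsd-2adic): BSD is not proved by any of this; nothing about the crux or its
children is asserted here — this file is pure `Λ`-module / Pontryagin algebra, the first half of the «weak local inputs» door
(sequel `…ZetaColemanMuIotaAdjointPairing.lean`).

WHY. p691108's `exists_involSemilinear_transpose` (the algebra under «the Λ-adic Poitou–Tate map into the tree's Selmer dual is
`ι`-semilinear», pen RC-373 (1) R-b / RC-383) takes a PERFECT dual pair `IsDualPair p ψ⁻ toDual` on the SOURCE `(X, S)` (in print: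
the local Iwasawa cohomology at `p` against the local `H¹(ℚ_{∞,p}, E[p^∞])`). Its proof uses from the source only the two
ADJOINTNESS fields `T_smul` (`toDual (T·x) s = toDual x (ψ⁻ s)`) and `C_smul` (constants through `ℤ_p → ℤ/p^k`) — never
bijectivity, never the local nilpotence of `ψ⁻`. This file records that: the typed local input at `2` the F1 slot needs from
local duality is ADJOINTNESS of the Λ-adic Tate pairing (equivariance (P2), kernel at finite layers) plus, downstream,
SURJECTIVITY onto the characters (Tate local duality, Milne ADT I Cor. 2.3, every `p`) — not a perfect `IsDualPair` on an
ordinary quotient.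

* §1 Pontryagin algebra for an ADJOINT pairing over `Λ = ℤ_p⟦T⟧`: iterated `T` (`X_pow_smul_of_adjoint`), the tail `(pⁿ, Tⁿ)`
  kills the piece `S_n` (`smul_mem_annPiece_of_adjoint`), truncation (`toDual_smul_eq_toDual_trunc_smul_of_adjoint`) — verbatim
  the `IsDualPair` lemmas of `IwasawaNakayamaProofs` / `IwasawaDualFunctorialityProofs` minus bijectivity.
* §2 `exists_involSemilinear_transpose_of_adjoint` — p691108's theorem with the source weakened to an adjoint pairing (target
  still a dual pair, e.g. `X(E/ℚ_∞)`); proof verbatim.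

References: [GreenbergLNM1716] §1 p. 60; [Lang1990] Ch. 5 §1; [MazurTateTeitelbaum1986Invent] Ch. I §17; [MilneADT2006] I Cor. 2.3;
tree p691108 (`…IotaTranspose`), `IwasawaNakayamaProofs`, `IwasawaDualFunctorialityProofs`.
-/

set_option autoImplicit false
set_option linter.dupNamespace false

noncomputable section

open scoped Classical MatrixGroups ModularForm NumberField
open CongruenceSubgroup WeierstrassCurve Field IsDedekindDomain NumberField
open Literature.NumberTheory.GaloisRepresentations
open Literature.NumberTheory.GaloisCohomology
open Literature.NumberTheory.EllipticCurves Literature.NumberTheory.EllipticCurves.ModularForms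
  Literature.NumberTheory.EllipticCurves.GreenbergSelmer
open Literature.NumberTheory.EllipticCurves.Kato2004
  Literature.NumberTheory.EllipticCurves.Kato2004.EulerSystemValues
open Literature.NumberTheory.EllipticCurves.IwasawaDual
open Literature.NumberTheory.EllipticCurves.Rank1Residual
open Literature.NumberTheory.EllipticCurves.Greenberg1999
open Summit.BirchSwinnertonDyer.Rank1Residual Summit.BirchSwinnertonDyer.Rank1Residual.X5
open Summit.BirchSwinnertonDyer.BirchSwinnertonDyer.Theorems.OrdKatoOptimalAtTwo
  Summit.BirchSwinnertonDyer.BirchSwinnertonDyer.Theorems.OrdKatoIntAtTwo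
open Summit.BirchSwinnertonDyer.BirchSwinnertonDyer.Theses.ByReductionTypeAtTwo

namespace Summit.BirchSwinnertonDyer.BirchSwinnertonDyer.Theorems.SteinbergFibreAtTwo

/-! ## §1 Pontryagin algebra for an ADJOINT pairing (no bijectivity, no local nilpotence) -/

section Adjoint

variable {p : ℕ} [Fact p.Prime]
  {S : Type*} [AddCommGroup S] {ψm : AddMonoid.End S}
  {X : Type*} [AddCommGroup X] [Module (IwasawaAlgebra p) X] {toDual : X →+ (S →+ AddCircle (1 : ℚ))}
  {S' : Type*} [AddCommGroup S'] {ψ' : AddMonoid.End S'}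
  {X' : Type*} [AddCommGroup X'] [Module (IwasawaAlgebra p) X'] {toDual' : X' →+ (S' →+ AddCircle (1 : ℚ))}

/-- Iterated `T`-adjointness: `toDual (Tʲ • x) s = toDual x (ψʲ s)` from `T_smul` alone. [folklore] -/
theorem X_pow_smul_of_adjoint
    (hT : ∀ (x : X) (s : S), toDual ((PowerSeries.X : IwasawaAlgebra p) • x) s = toDual x (ψm s))
    (j : ℕ) (x : X) (s : S) :
    toDual ((PowerSeries.X : IwasawaAlgebra p) ^ j • x) s = toDual x ((ψm ^ j) s) := by
  induction j generalizing s with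
  | zero => simp
  | succ j ih =>
    rw [pow_succ', mul_smul, hT, ih, pow_succ, AddMonoid.End.coe_mul, Function.comp_apply]

/-- **The tail `(pⁿ, Tⁿ)` acts into the annihilator of the piece `S_n`** for an ADJOINT pairing: a power series whose
coefficients of degree `< n` are divisible by `pⁿ` is `pⁿ u + Tⁿ v`, and `toDual (pⁿ • ·) = 0` on `pⁿ`-torsion (`C_smul`),
`toDual (Tⁿ • ·) s = toDual · (ψⁿ s)` (`T_smul`). Verbatim `IsDualPair.smul_mem_annPiece` without bijectivity. [cite: Lang1990, Ch. 5 §1] -/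
theorem smul_mem_annPiece_of_adjoint
    (hT : ∀ (x : X) (s : S), toDual ((PowerSeries.X : IwasawaAlgebra p) • x) s = toDual x (ψm s))
    (hC : ∀ (c : ℤ_[p]) (x : X) (s : S) (k : ℕ), p ^ k • s = 0 →
      toDual (PowerSeries.C c • x) s = (PadicInt.toZModPow k c).val • toDual x s)
    {n : ℕ} {f : IwasawaAlgebra p} (hf : ∀ j < n, (p : ℤ_[p]) ^ n ∣ PowerSeries.coeff j f) (g : X) :
    f • g ∈ annPiece p ψm toDual n := by
  have hXd : (PowerSeries.X : IwasawaAlgebra p) ^ n ∣ f - (PowerSeries.trunc n f : IwasawaAlgebra p) := by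
    rw [PowerSeries.X_pow_dvd_iff]
    intro m hm
    rw [map_sub, Polynomial.coeff_coe, PowerSeries.coeff_trunc, if_pos hm, sub_self]
  obtain ⟨v, hv⟩ := hXd
  have hCd : Polynomial.C ((p : ℤ_[p]) ^ n) ∣ PowerSeries.trunc n f := by
    rw [Polynomial.C_dvd_iff_dvd_coeff]
    intro j
    rw [PowerSeries.coeff_trunc]
    split_ifs with hj
    · exact hf j hj
    · exact dvd_zero _
  obtain ⟨q, hq⟩ := hCd
  have hf' : f = PowerSeries.C ((p : ℤ_[p]) ^ n) * (q : IwasawaAlgebra p) +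
      (PowerSeries.X : IwasawaAlgebra p) ^ n * v := by
    rw [← hv, ← Polynomial.coe_C, ← Polynomial.coe_mul, ← hq]; ring
  intro s hs
  rw [hf', add_smul, map_add, AddMonoidHom.add_apply, mul_smul, mul_smul,
    hC _ _ s n hs.1, X_pow_smul_of_adjoint hT, hs.2, map_zero, add_zero]
  have h0 : PadicInt.toZModPow n ((p : ℤ_[p]) ^ n) = 0 := by
    rw [map_pow, map_natCast, ← Nat.cast_pow, ZMod.natCast_self]
  rw [h0, ZMod.val_zero, zero_smul]

/-- **A power series acts on a piece through its truncation** for an ADJOINT pairing: for `s ∈ S_n`,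
`toDual (f • x) s = toDual ((trunc_n f) • x) s`. Verbatim `IsDualPair.toDual_smul_eq_toDual_trunc_smul` without bijectivity.
[cite: Lang1990, Ch. 5 §1] -/
theorem toDual_smul_eq_toDual_trunc_smul_of_adjoint
    (hT : ∀ (x : X) (s : S), toDual ((PowerSeries.X : IwasawaAlgebra p) • x) s = toDual x (ψm s))
    (hC : ∀ (c : ℤ_[p]) (x : X) (s : S) (k : ℕ), p ^ k • s = 0 →
      toDual (PowerSeries.C c • x) s = (PadicInt.toZModPow k c).val • toDual x s)
    (f : IwasawaAlgebra p) (x : X) {n : ℕ} {s : S} (hs : s ∈ piece p ψm n) :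
    toDual (f • x) s = toDual (((PowerSeries.trunc n f : Polynomial ℤ_[p]) : IwasawaAlgebra p) • x) s := by
  have hann : (f - ((PowerSeries.trunc n f : Polynomial ℤ_[p]) : IwasawaAlgebra p)) • x ∈ annPiece p ψm toDual n :=
    smul_mem_annPiece_of_adjoint hT hC (fun j hj ↦ by
      rw [map_sub, Polynomial.coeff_coe, PowerSeries.coeff_trunc, if_pos hj, sub_self]
      exact dvd_zero _) x
  have h0 := hann s hs
  rwa [sub_smul, map_sub, AddMonoidHom.sub_apply, sub_eq_zero] at h0

/-! ## §2 The `ι`-semilinear transpose from an ADJOINT source pairing -/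

/-- **The `ι`-semilinear transpose, adjoint-source form.** Let `toDual : X → Hom(S, ℚ/ℤ)` be ADJOINT over `Λ = ℤ_p⟦T⟧` for
the key `ψ⁻` — `toDual (T·x) s = toDual x (ψ⁻ s)` and constants act through `ℤ_p → ℤ/p^k` on `p^k`-torsion `s` — (NO
bijectivity, NO local nilpotence asked of the source), let `(X', S', ψ', toDual')` be a dual pair (`IsDualPair`), `ψ` an
endomorphism of `S` with `(1 + ψ⁻)(1 + ψ) = 1 = (1 + ψ)(1 + ψ⁻)`, and `φ : S' → S` additive with `φ ∘ ψ' = ψ ∘ φ`. Then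
`x ↦ toDual'⁻¹ (toDual x ∘ φ)` is `ι`-SEMILINEAR (`ι : T ↦ (1+T)⁻¹ − 1`). The proof is p691108's
`exists_involSemilinear_transpose` verbatim, the two uses of the source's `IsDualPair` fields being exactly `T_smul`/`C_smul`.
[cite: GreenbergLNM1716, §1 p. 60 (the two Λ-structures on a Pontryagin dual)] [cite: Lang1990, Ch. 5 §1]
[cite: MazurTateTeitelbaum1986Invent, Ch. I §17] -/
theorem exists_involSemilinear_transpose_of_adjoint
    (hT : ∀ (x : X) (s : S), toDual ((PowerSeries.X : IwasawaAlgebra p) • x) s = toDual x (ψm s))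
    (hC : ∀ (c : ℤ_[p]) (x : X) (s : S) (k : ℕ), p ^ k • s = 0 →
      toDual (PowerSeries.C c • x) s = (PadicInt.toZModPow k c).val • toDual x s)
    (h' : IsDualPair p ψ' toDual')
    (ψ : AddMonoid.End S) (hψ₁ : (1 + ψm) * (1 + ψ) = 1) (hψ₂ : (1 + ψ) * (1 + ψm) = 1)
    (φ : S' →+ S) (hφ : ∀ s', φ (ψ' s') = ψ (φ s')) :
    ∃ F : X →ₛₗ[((IwasawaAlgebra.involEquiv p).toRingEquiv : IwasawaAlgebra p →+* IwasawaAlgebra p)] X',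
      ∀ (x : X) (s' : S'), toDual' (F x) s' = toDual x (φ s') := by
  -- the transpose as an additive map
  let e' : X' ≃+ (S' →+ AddCircle (1 : ℚ)) := AddEquiv.ofBijective toDual' h'.bijective
  let F₀ : X →+ X' :=
    { toFun := fun x ↦ e'.symm ((toDual x).comp φ)
      map_zero' := by
        apply e'.injective
        rw [AddEquiv.apply_symm_apply, map_zero, map_zero, AddMonoidHom.zero_comp]
      map_add' := fun x y ↦ by
        apply e'.injective
        rw [AddEquiv.apply_symm_apply, map_add, map_add, AddEquiv.apply_symm_apply, AddEquiv.apply_symm_apply,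
          AddMonoidHom.add_comp] }
  have hF₀ : ∀ (x : X) (s' : S'), toDual' (F₀ x) s' = toDual x (φ s') := fun x s' ↦ by
    change e' (e'.symm ((toDual x).comp φ)) s' = _
    rw [AddEquiv.apply_symm_apply, AddMonoidHom.comp_apply]
  -- algebra of the two keys: `ψ⁻ = -ψ - ψ⁻ ψ` and `ψ⁻` commutes with `ψ`
  have hψm_eq : ψm = -((1 + ψm) * ψ) := by
    have h2 : (1 + ψm) * (1 + ψ) = (1 + ψm) + (1 + ψm) * ψ := by rw [mul_add, mul_one]
    rw [hψ₁] at h2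
    have h3 : ψm + (1 + ψm) * ψ = 0 := by
      have h4 : (1 : AddMonoid.End S) + (ψm + (1 + ψm) * ψ) = 1 + 0 := by
        rw [add_zero, ← add_assoc]
        exact h2.symm
      exact add_left_cancel h4
    exact eq_neg_of_add_eq_zero_left h3
  have hkey : ∀ t : S, ψm t = -(ψ t) - ψm (ψ t) := by
    intro t
    calc ψm t = (-((1 + ψm) * ψ)) t := by rw [← hψm_eq]
      _ = -(ψ t) - ψm (ψ t) := by
          show -(ψ t + ψm (ψ t)) = -(ψ t) - ψm (ψ t)
          rw [neg_add']
  have hcomm : Commute (1 + ψm) ψ := by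
    have hc : Commute (1 + ψm) (1 + ψ) := by
      change (1 + ψm) * (1 + ψ) = (1 + ψ) * (1 + ψm)
      rw [hψ₁, hψ₂]
    have hc2 := hc.sub_right (Commute.one_right (1 + ψm))
    rwa [add_sub_cancel_left] at hc2
  have hψm_pow_apply : ∀ (n : ℕ) (t : S), (ψ ^ n) t = 0 → (ψm ^ n) t = 0 := by
    intro n t ht
    have h5 : ψm ^ n = (-((1 + ψm) * ψ)) ^ n := by rw [← hψm_eq]
    rw [h5, neg_pow, hcomm.mul_pow, AddMonoid.End.coe_mul, Function.comp_apply, AddMonoid.End.coe_mul,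
      Function.comp_apply, ht, map_zero, map_zero]
  -- constants act alike on both sides
  have hCF : ∀ (c : ℤ_[p]) (x : X), F₀ (PowerSeries.C c • x) = PowerSeries.C c • F₀ x := by
    intro c x
    apply h'.bijective.1
    ext s'
    obtain ⟨k, hk⟩ := h'.locNil.torsion s'
    have hk' : p ^ k • φ s' = 0 := by rw [← map_nsmul, hk, map_zero]
    rw [hF₀, hC c x (φ s') k hk', h'.C_smul c (F₀ x) s' k hk, hF₀]
  -- `T` acts on the transpose through `ι(T) = (1+T)⁻¹ − 1`
  have hTF : ∀ x : X, F₀ ((PowerSeries.X : IwasawaAlgebra p) • x) = IwasawaAlgebra.invSubOne p • F₀ x := by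
    intro x
    set z : X' := IwasawaAlgebra.invSubOne p • F₀ x with hz
    have h1z : (1 + PowerSeries.X : IwasawaAlgebra p) • z = -((PowerSeries.X : IwasawaAlgebra p) • F₀ x) := by
      rw [hz, ← mul_smul, ← neg_smul]
      congr 1
      have hm := IwasawaAlgebra.one_add_X_mul_one_add_invSubOne p
      rw [mul_add, mul_one] at hm
      linear_combination (exp := 1) hm
    have hrec : ∀ s', toDual' z s' = -(toDual x (ψ (φ s'))) - toDual' z (ψ' s') := by
      intro s'
      have hl : toDual' ((1 + PowerSeries.X : IwasawaAlgebra p) • z) s' = toDual' z s' + toDual' z (ψ' s') := by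
        rw [add_smul, one_smul, map_add, AddMonoidHom.add_apply, h'.T_smul]
      have hr : toDual' (-((PowerSeries.X : IwasawaAlgebra p) • F₀ x)) s' = -(toDual x (ψ (φ s'))) := by
        rw [map_neg, AddMonoidHom.neg_apply, h'.T_smul, hF₀, hφ]
      rw [h1z] at hl
      rw [hl] at hr
      exact eq_sub_of_add_eq hr
    have hind : ∀ (n : ℕ) (s' : S'), (ψ' ^ n) s' = 0 → toDual' z s' = toDual x (ψm (φ s')) := by
      intro n
      induction n with
      | zero =>
        intro s' hs'
        rw [pow_zero, AddMonoid.End.coe_one, id_eq] at hs'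
        rw [hs', map_zero, map_zero, map_zero, map_zero]
      | succ n ih =>
        intro s' hs'
        have hs'' : (ψ' ^ n) (ψ' s') = 0 := by
          rwa [pow_succ, AddMonoid.End.coe_mul, Function.comp_apply] at hs'
        rw [hrec s', ih (ψ' s') hs'', hφ, hkey (φ s'), map_sub, map_neg]
    apply h'.bijective.1
    ext s'
    obtain ⟨n, hn⟩ := h'.locNil.nil s'
    rw [hF₀, hT, ← hind n s' hn]
  -- powers of `T`
  have hTpow : ∀ (j : ℕ) (x : X), F₀ ((PowerSeries.X : IwasawaAlgebra p) ^ j • x) =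
      IwasawaAlgebra.invSubOne p ^ j • F₀ x := by
    intro j
    induction j with
    | zero => intro x; rw [pow_zero, pow_zero, one_smul, one_smul]
    | succ j ih => intro x; rw [pow_succ', mul_smul, hTF, ih, ← mul_smul, ← pow_succ']
  -- polynomials
  have hpoly : ∀ (q : Polynomial ℤ_[p]) (x : X),
      F₀ ((q : IwasawaAlgebra p) • x) = IwasawaAlgebra.invol p (q : IwasawaAlgebra p) • F₀ x := by
    intro q x
    induction q using Polynomial.induction_on' with
    | add q r hq hr => rw [Polynomial.coe_add, add_smul, map_add, map_add, add_smul, hq, hr]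
    | monomial j c =>
      rw [← Polynomial.C_mul_X_pow_eq_monomial, Polynomial.coe_mul, Polynomial.coe_pow, Polynomial.coe_C,
        Polynomial.coe_X, mul_smul, hCF, hTpow, map_mul, map_pow, IwasawaAlgebra.invol_C, IwasawaAlgebra.invol_X,
        mul_smul]
  -- `ι` maps `(Tⁿ)` into `(Tⁿ)`: the tail acts into the annihilator of `S'_n`
  have htail : ∀ (n : ℕ) (f : IwasawaAlgebra p), ∀ j < n, (p : ℤ_[p]) ^ n ∣
      PowerSeries.coeff j (IwasawaAlgebra.invol p
        (f - ((PowerSeries.trunc n f : Polynomial ℤ_[p]) : IwasawaAlgebra p))) := by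
    intro n f j hj
    have hX : (PowerSeries.X : IwasawaAlgebra p) ^ n ∣
        f - ((PowerSeries.trunc n f : Polynomial ℤ_[p]) : IwasawaAlgebra p) := by
      rw [PowerSeries.X_pow_dvd_iff]
      intro m hm
      rw [map_sub, Polynomial.coeff_coe, PowerSeries.coeff_trunc, if_pos hm, sub_self]
    obtain ⟨v, hv⟩ := hX
    have hXι : (PowerSeries.X : IwasawaAlgebra p) ^ n ∣
        IwasawaAlgebra.invol p (f - ((PowerSeries.trunc n f : Polynomial ℤ_[p]) : IwasawaAlgebra p)) := by
      rw [hv, map_mul, map_pow, IwasawaAlgebra.invol_X]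
      exact Dvd.dvd.mul_right (pow_dvd_pow_of_dvd
        (PowerSeries.X_dvd_iff.2 (IwasawaAlgebra.constantCoeff_invSubOne p)) n) _
    rw [PowerSeries.X_pow_dvd_iff] at hXι
    rw [hXι j hj]
    exact dvd_zero _
  -- `ι`-semilinearity through the pieces of `S'`
  have hsmul : ∀ (f : IwasawaAlgebra p) (x : X), F₀ (f • x) = IwasawaAlgebra.invol p f • F₀ x := by
    intro f x
    rw [← sub_eq_zero]
    refine h'.eq_zero_of_forall_mem_annPiece fun n s' hs' ↦ ?_
    have hφs' : φ s' ∈ piece p ψm n := by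
      rw [mem_piece] at hs' ⊢
      refine ⟨by rw [← map_nsmul, hs'.1, map_zero], hψm_pow_apply n (φ s') ?_⟩
      rw [← map_pow_apply_of_map_apply φ hφ, hs'.2, map_zero]
    have hdecomp : IwasawaAlgebra.invol p f =
        IwasawaAlgebra.invol p ((PowerSeries.trunc n f : Polynomial ℤ_[p]) : IwasawaAlgebra p) +
        IwasawaAlgebra.invol p (f - ((PowerSeries.trunc n f : Polynomial ℤ_[p]) : IwasawaAlgebra p)) := by
      rw [← map_add, add_sub_cancel]
    rw [map_sub, AddMonoidHom.sub_apply, sub_eq_zero, hF₀, toDual_smul_eq_toDual_trunc_smul_of_adjoint hT hC f x hφs',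
      ← hF₀, hpoly, hdecomp, add_smul, map_add, AddMonoidHom.add_apply,
      h'.smul_mem_annPiece (htail n f) (F₀ x) s' hs', add_zero]
  refine ⟨{ toFun := F₀, map_add' := F₀.map_add, map_smul' := fun r x ↦ ?_ }, hF₀⟩
  change F₀ (r • x) = IwasawaAlgebra.invol p r • F₀ x
  exact hsmul r x

end Adjoint

end Summit.BirchSwinnertonDyer.BirchSwinnertonDyer.Theorems.SteinbergFibreAtTwo

end
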